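import Summits.KontsevichZagierPeriods.KontsevichZagierPeriods.Theses.RootDecompRelativeModAbsolute

/-!
# Route RootDecompRelativeModAbsolute — `KZModRelTwoPiGlue` (item stmt-KontsevichZagierPeriods-28740)

GLUE of the gen-6 split (k = 3) of the declared residual E = `KZModRelTwoPi` (item 26670) of node C″:
`DimThreeModRelTwo → RelTailModAbs → AbsTailModRel → KZModRelTwoPi` (children 28737 · 28738 · 28739).
Proof (= `kzModRelTwoPi_of_tails` of the decomp-kz lens-3 gen-6 node file
`run/shared/lean/pub/decomp-kz/decomp-kz-lens-3/g6/RelativeModAbsoluteLanden.lean`, critic CLEARED 2026-08-30T05:35:03Z,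
retargeted to the route declarations by name): in an admissible `R` ([π]-saturated two-sided ideal ⊇ relations, closed
under the born O₂-oracle), Abs₃ holds by C₃; Abs_{j+4} follows from Abs_{j+3} through the fibre oracle O_{j+3} (RelTail
then AbsTail) — induction on `j`; finally every equal-valued pair of rational representations of any two dimensions
`n, m` is padded to the common dimension `n + m + 3` (`KZ.IntegralRep.exists_equivalent_of_le`, relations) and compared
there. Standard axioms, 0 sorry.
-/

namespace Summit.KontsevichZagierPeriods.RootDecompRelativeModAbsolute

open Literature.NumberTheory.Transcendental
open Summit.KontsevichZagierPeriods.KontsevichZagierPeriods.Theses.RootDecompRelativeModAbsolute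

/-- **KZModRelTwoPiGlue** (item stmt-KontsevichZagierPeriods-28740):
`DimThreeModRelTwo → RelTailModAbs → AbsTailModRel → KZModRelTwoPi` — Abs₃ from C₃, Abs_{j+4} from Abs_{j+3} through
O_{j+3}, then every equal-valued pair by dimension padding. -/
theorem kzModRelTwoPiGlue_proof :
    Summit.KontsevichZagierPeriods.KontsevichZagierPeriods.Theses.RootDecompRelativeModAbsolute.KZModRelTwoPiGlue := by
  unfold Summit.KontsevichZagierPeriods.KontsevichZagierPeriods.Theses.RootDecompRelativeModAbsolute.KZModRelTwoPiGlue
  intro hC₃ hRel hAbs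
  unfold Summit.KontsevichZagierPeriods.KontsevichZagierPeriods.Theses.RootDecompRelativeModAbsolute.KZModRelTwoPi
  intro R hR hI hπ hO₂ n m r r' _ _ hv
  -- Abs at every dimension ≥ 3, by induction through the two tails
  have hA : ∀ j : ℕ, ∀ (s s' : KZ.IntegralRep (j + 3)), s.value = s'.value → KZ.of s - KZ.of s' ∈ R := by
    intro j
    induction j with
    | zero => exact hC₃ R hR hI hπ hO₂
    | succ j ih => exact hAbs j R hR hI hπ (hRel j R hR hI hπ ih)
  -- pad both representations to the common dimension n + m + 3
  obtain ⟨ρ, hρ⟩ := r.exists_equivalent_of_le (N := n + m + 3) (by omega)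
  obtain ⟨ρ', hρ'⟩ := r'.exists_equivalent_of_le (N := n + m + 3) (by omega)
  have hvρ : ρ.value = ρ'.value := by
    rw [← KZ.Equivalent.value_eq_holds hρ, ← KZ.Equivalent.value_eq_holds hρ', hv]
  have h3 : KZ.of ρ - KZ.of ρ' ∈ R := hA (n + m) ρ ρ' hvρ
  have e : KZ.of r - KZ.of r' = (KZ.of r - KZ.of ρ) + (KZ.of ρ - KZ.of ρ') - (KZ.of r' - KZ.of ρ') := by abel
  rw [e]
  exact R.sub_mem (R.add_mem (hR hρ) h3) (hR hρ')

end Summit.KontsevichZagierPeriods.RootDecompRelativeModAbsolute
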